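import Summits.CriticalPhenomena.Ising3DConformalLimit.Theorems.SynchronousCouplingRotationJoiningL2Gluing

/-!
# Route `SynchronousCoupling`, crux `RotationJoining` (stmt-CriticalPhenomena-18763), line `SketchIdeator2`:
`L²` limits of geometrically `L²`-Cauchy sequences (tool for `stub_qualitativeOfFDDIsotropy`)

Pure measure theory, no lattice input. If `Z 0, Z 1, …` are bounded measurable real functions on a probability
space `(Ω, P)` with `‖Z (k+1) − Z k‖_{L²(P)} ≤ a rᵏ` for all `k` (`0 ≤ a`, `0 ≤ r < 1`), then there is a
measurable `Zinf ∈ L²(P)` with `‖Z k − Zinf‖_{L²(P)} ≤ a rᵏ / (1 − r)` for every `k`.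

Proof: the classes of the `Z k` in the complete space `Lp ℝ 2 P` have geometrically decaying steps, so they
converge (`cauchySeq_of_le_geometric`); the tail bound is Mathlib's `dist_le_of_le_geometric_of_tendsto`; the
canonical representative of the limit class is strongly measurable. The only bookkeeping is the identity
`eLpNorm f 2 μ = ENNReal.ofReal √(∫ f ^ 2 ∂μ)` for `f ∈ L²`. `stub_l2LimitOfGeometric` is the registered
specialisation to the chain space `ℕ → SpinConfig (Site 3)`.
-/

noncomputable section

namespace Summit.CriticalPhenomena.Ising3DConformalLimit.Cruxes.RotationJoining.RateSplitting

open MeasureTheory ProbabilityTheory Filter Topology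

section General

variable {Ω : Type*} [MeasurableSpace Ω] {μ : Measure Ω}

/-- For a real function in `L²`, `eLpNorm f 2 μ = ENNReal.ofReal √(∫ f ^ 2 ∂μ)`. -/
theorem eLpNorm_two_eq_ofReal_sqrt {f : Ω → ℝ} (hf : MemLp f 2 μ) :
    eLpNorm f 2 μ = ENNReal.ofReal (Real.sqrt (∫ x, f x ^ 2 ∂μ)) := by
  rw [hf.eLpNorm_eq_integral_rpow_norm two_ne_zero ENNReal.ofNat_ne_top, ENNReal.toReal_ofNat,
    Real.sqrt_eq_rpow, one_div]
  congr 2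
  refine integral_congr_ae (ae_of_all _ fun x => ?_)
  simp only [Real.norm_eq_abs, Real.rpow_two, sq_abs]

/-- The distance of the classes of two `L²` functions in `Lp ℝ 2 μ` is `√(∫ (f - g) ^ 2 ∂μ)`. -/
theorem dist_toLp_eq_sqrt {f g : Ω → ℝ} (hf : MemLp f 2 μ) (hg : MemLp g 2 μ) :
    dist (hf.toLp f) (hg.toLp g) = Real.sqrt (∫ x, (f x - g x) ^ 2 ∂μ) := by
  rw [Lp.dist_def, eLpNorm_congr_ae (hf.coeFn_toLp.sub hg.coeFn_toLp),
    eLpNorm_two_eq_ofReal_sqrt (hf.sub hg), ENNReal.toReal_ofReal (Real.sqrt_nonneg _)]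
  simp only [Pi.sub_apply]

/-- **`L²` limit of a geometrically `L²`-Cauchy sequence, with the tail bound.** Bounded measurable real
functions `Z k` on a probability space with `∫ (Z (k+1) − Z k)² ≤ (a rᵏ)²` (`0 ≤ a`, `0 ≤ r < 1`) converge in
`L²` to a measurable square-integrable `Zinf` with `∫ (Z k − Zinf)² ≤ (a rᵏ / (1 − r))²` for every `k`. -/
theorem exists_l2Limit_of_geometric (P : Measure Ω) [IsProbabilityMeasure P] (Z : ℕ → Ω → ℝ) (a r : ℝ)
    (ha : 0 ≤ a) (hr0 : 0 ≤ r) (hr1 : r < 1) (hZm : ∀ k, Measurable (Z k))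
    (hZb : ∀ k, ∃ B, ∀ ω, |Z k ω| ≤ B)
    (hinc : ∀ k, ∫ ω, (Z (k + 1) ω - Z k ω) ^ 2 ∂P ≤ (a * r ^ k) ^ 2) :
    ∃ Zinf : Ω → ℝ, Measurable Zinf ∧ MemLp Zinf 2 P ∧
      ∀ k, ∫ ω, (Z k ω - Zinf ω) ^ 2 ∂P ≤ (a * r ^ k / (1 - r)) ^ 2 := by
  -- each `Z k` is in `L²`
  have hmem : ∀ k, MemLp (Z k) 2 P := fun k => by
    obtain ⟨B, hB⟩ := hZb k
    exact MemLp.of_bound (hZm k).aestronglyMeasurable B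
      (ae_of_all _ fun ω => by rw [Real.norm_eq_abs]; exact hB ω)
  -- the classes in the complete space `Lp ℝ 2 P` have geometrically decaying steps
  set u : ℕ → Lp ℝ 2 P := fun k => (hmem k).toLp (Z k) with hu_def
  have hu : ∀ k, dist (u k) (u (k + 1)) ≤ a * r ^ k := by
    intro k
    have hk : 0 ≤ a * r ^ k := mul_nonneg ha (pow_nonneg hr0 k)
    rw [hu_def, dist_comm, dist_toLp_eq_sqrt (hmem (k + 1)) (hmem k)]
    calc Real.sqrt (∫ ω, (Z (k + 1) ω - Z k ω) ^ 2 ∂P) ≤ Real.sqrt ((a * r ^ k) ^ 2) :=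
          Real.sqrt_le_sqrt (hinc k)
      _ = a * r ^ k := Real.sqrt_sq hk
  obtain ⟨L, hL⟩ := cauchySeq_tendsto_of_complete (cauchySeq_of_le_geometric r a hr1 hu)
  refine ⟨⇑L, (Lp.stronglyMeasurable L).measurable, Lp.memLp L, fun k => ?_⟩
  have hdist : dist (u k) L ≤ a * r ^ k / (1 - r) := dist_le_of_le_geometric_of_tendsto r a hr1 hu hL k
  rw [← Lp.toLp_coeFn L (Lp.memLp L), hu_def, dist_toLp_eq_sqrt (hmem k) (Lp.memLp L)] at hdist
  exact (Real.sqrt_le_iff.mp hdist).2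

end General

/-! ### Registered specialisation to the chain space over Ising configurations on `ℤ³` -/

open Literature.Probability.LatticeModels

/-- **Registered sub-goal `stub_l2LimitOfGeometric`** (tool of `stub_qualitativeOfFDDIsotropy`): `L²` limit of
a geometrically `L²`-Cauchy sequence of bounded measurable functions on the chain space, with the tail bound. -/
theorem stub_l2LimitOfGeometric :
    ∀ (P : Measure (ℕ → SpinConfig (Site 3))) [IsProbabilityMeasure P] (Z : ℕ → (ℕ → SpinConfig (Site 3)) → ℝ)
      (a r : ℝ), 0 ≤ a → 0 ≤ r → r < 1 → (∀ k, Measurable (Z k)) → (∀ k, ∃ B, ∀ ω, |Z k ω| ≤ B) →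
      (∀ k, ∫ ω, (Z (k + 1) ω - Z k ω) ^ 2 ∂P ≤ (a * r ^ k) ^ 2) →
      ∃ Zinf : (ℕ → SpinConfig (Site 3)) → ℝ, Measurable Zinf ∧ MemLp Zinf 2 P ∧
        ∀ k, ∫ ω, (Z k ω - Zinf ω) ^ 2 ∂P ≤ (a * r ^ k / (1 - r)) ^ 2 :=
  fun P _ Z a r ha hr0 hr1 hZm hZb hinc => exists_l2Limit_of_geometric P Z a r ha hr0 hr1 hZm hZb hinc

end Summit.CriticalPhenomena.Ising3DConformalLimit.Cruxes.RotationJoining.RateSplitting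

end
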